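import Summits.Ventures.FusionMHD.Bench.SolovevPCFIterMercierEdgeThreshold
import Summits.Ventures.FusionMHD.Bench.SolovevPCFIterResistiveEdgeData
import Summits.Ventures.FusionMHD.Models.SolovevPCFResistiveIndex
import HarnessLib

/-!
# F1.DR — the RESISTIVE-INTERCHANGE INDEX `D_R` (Glasser–Greene–Johnson; Zheng (3.42)) of the EDGE surface of the
# ITER-like PCF Solov'ev equilibrium, end to end in the kernel: closed form in the free constant `g = F = RB_φ`, SIGN at
# the F list of record, exact monotone structure and the two-sided certified threshold `g_R(edge) ∈ [0.37803332628, 0.37803332632]`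
(venture LADDER-GRIDFUSION, rung F1 sub-rung F1.DR — AUTHORISED v1.3.0, director RULING 22 (3) 2026-08-27T03:03:05Z; lead
03:15:36Z (b), 03:37:37Z (1), R-DR-FLIST 03:53:49Z (2); cell `gridfusion`, seat `gridfusion-model-7` (g0), 2026-08-27.
Objects: `IterLike.resistiveIndex` / `IterLike.avgBsq` of `Models/SolovevPCFResistiveIndex.lean` (gridfusion-model-5, p492374) on
`Solovev.lcResistiveIndex` (`Literature/…/SolovevFluxSurfaceGGJResistive.lean`, p491654) and lit-3's printed `SurfaceData.ggjDR`
(`MercierFluxForm.lean` §9, p487005); edge dictionary, atomic integrals `K₁…K₈`, brackets `A4, A6, A7, phihat`, `M₂, M₀` and the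
record identity `IterLike.ggjData g (ε/R_a) = lcEdgeData g` of gridfusion-sos-6's `…MercierEdge{Data1,Data2,Averages,GGJ,FluxForm,
Subst,Integrals1,Integrals2,Kernel,Threshold}` (p478089 … p492537); the ONE new enclosure `K₉` of `…ResistiveEdgeData` (this seat).)

## The statement (three columns, never merged)
CERTIFIED (kernel, this file), for the EDGE surface `r = ε/R_a` (`Ψ = 0`) of the ITER-like instance and the free constant `g = F > 0`:
* `integral_gradSq_w_div_u_edge`: the one new atomic integral `∫₀^{2π} |∇Ψ|²·w/u dt = (4αρ²κ₀/c)·K₉`; `avgBsq_edge`: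
  `⟨B²⟩(edge) = g²·A4 + A9` with `A9 = ⟨B_p²⟩ = 4αρ²K₉/K₁ ∈ [0.0368264552452, 0.0368264552453]`;
* `resistiveIndex_edge_eq`: **`D_R(g) = −(M₂ − M₀/g²)/(4π²·phihat²) + (H(g) − 1/2)²`**, `H(g) = ((g²A7 + A4)/(g²A4 + A9) − A6)/(2π·phihat)`
  (`= mercierD − 1/4 + (H − 1/2)²` of model-5 with sos-6's edge fields: `V′ = Vp`, `Λ = −2π·g·phihat·Vp`, `⟨B²/G⟩ = g²A7 + A4`,
  `⟨σB²/G⟩ = gA6`, Jardin's `F = M₂g² − M₀`); sign form `D_R < 0 ↔ resNum g < 0` with the POLYNOMIAL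
  `resNum g = X(g)²g² − (M₂g² − M₀)(g²A4 + A9)²`, `X(g) = g²A7 + A4 − (A6 + π·phihat)(g²A4 + A9)`;
* THE ROW (R-DR-FLIST shape of record, fixed rational F list, edge surface): **`D_R(3/5) < 0`, `D_R(1) < 0`, `D_R(F_M⁺) < 0`**
  (`F_M⁺ = MercierAxis.FmercHi = 0.61902799408906489485`), with certified value enclosures `D_R(3/5) ∈ [−0.788738, −0.788737]`,
  `D_R(1) ∈ [−1.119434, −1.119433]` and the certified ORDER `D_R(1) < D_R(F_M⁺) < D_R(3/5)` (`…Threshold`); the VALUE at `F_M⁺` is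
  NOT enclosed in the kernel — VALIDATED only: `D_R(F_M⁺) ≈ −0.820073` (box B `−0.8201`; ref-1 own `−0.820073358061`, LEDGER-1 row 201);
* STRUCTURE (exact, numerics only in two certified sign conditions `A4² < A7·A9` and `X(g) < 0`): `H` is increasing in `g` and
  `< 1/2` on `(0, ∞)`, hence **`D_R` is STRICTLY DECREASING in `g` on `(0, ∞)`** (`resistiveIndex_edge_strictAntiOn`) — so the
  «∀ g ≥ g₀» form needs no derivative bound: **`∀ g ≥ 0.37803332632, D_R(g) < 0`** and **`∀ 0 < g ≤ 0.37803332628, D_R(g) > 0`**,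
  i.e. the edge resistive-interchange threshold is certified two-sided, `g_R(edge) ∈ [0.37803332628, 0.37803332632]` (width 4·10⁻¹¹),
  above the edge Mercier threshold `g_M(edge) ≤ 0.36703156248` (`gMercEdgeHi_lt_gResEdgeLo`; consistent with `D_I ≤ D_R`);
* kernel consequence (model-5's `mercierCriterion_of_resistiveIndex_neg`): `D_R < 0 ⇒` Jardin's Mercier criterion (8.134) on the
  same record — `mercierCriterion_edge_of_ge_gRes`.
LABEL (lead 03:15:36Z (b)): «RESISTIVE-INTERCHANGE INDEX SIGN (criterion as printed, Zheng (3.42) / GGJ 1975) — not a tearing /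
resistive-wall statement».  MODELLED (not certified here): the ANALYTIC Pataki–Cerfon–Freidberg Solov'ev equilibrium (ideal MHD,
axisymmetric, `μ₀p′ = −1`, `FF′ = 0`, fixed boundary; «ITER-like» names the printed shape triple `(8/25, 17/10, 33/100)` of
[cite: PatakiCerfonFreidberg2013, §6.1] only, not ITER); `D_R` is the printed index of the GGJ resistive singular-layer theory
EVALUATED ON these ideal-equilibrium inputs — «when `D_R > 0` … resistive interchange modes» (Zheng §3.2), in a tokamak «normally a
small negative number» (HamEtAl2013 — a VALIDATED expectation, here CERTIFIED for the model's edge surface); `F = RB_φ` is a free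
parameter of the Solov'ev profiles, so every statement is F-parametric; WHAT-THIS-IS-NOT (4): no operational prediction, nothing
here says any plasma or device is stable.  VALIDATED (box B, independent lineage, not used in proofs): gridfusion-model-5
`bench/F1DR-validated-lineageB.json` d2ab886dc86d0018 (mpmath GL 34 dps): `D_R = −0.7887 / −0.8201 / −1.1194` at `g = 3/5 / F_M / 1`,
`∫G·w/u = 0.547825678551`, `⟨B_p²⟩ = 0.036826455`; ref-1 prep 03:51:52Z (own AGM/elliptic closed form): `⟨B_p²⟩ ∈
[0.0368264552452620957041302, …386]`; this seat's third float lineage `cert/model-7/dr_check.py` (Simpson in `w`) agrees to all digits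
and gives `g_R(edge) ≈ 0.378033326303`.  Box set (RULING 22 / F1 rule): L = this file + `…ResistiveEdgeData` (p-ids on STATUS);
D = model-5 literal-compare — BY REFERENCE (instance decls `IterLike.*` only; the new literals are the `K₉` certificate and the
brackets derived in §2/§5); R1 = ref-1 (`⟨B_p²⟩`, `D_R` values, `g_R`); R2 = ref-2 (p491654/p492374 vs Zheng (2.64)/(3.42)).
No `native_decide`; no `decide` in this file (the enclosures are the imported Data files'); `norm_num`/`linarith`/`nlinarith` only.
-/

noncomputable section

open Real MeasureTheory Set intervalIntegral
open Literature.Analysis.ValidatedNumerics Literature.Analysis.ValidatedNumerics.PolyMP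
open Literature.Analysis.ValidatedNumerics.ExpPoly (Poly)
open Literature.MathematicalPhysics.MHD Literature.MathematicalPhysics.MHD.Solovev
open Literature.MathematicalPhysics.MHD.Mercier.FluxForm
open Summit.Ventures.FusionMHD.Models.SolovevPCF

namespace Summit.Ventures.FusionMHD.Bench.SolovevPCFIter.MercierEdge

/-! ## §1 The one new atomic `t`-integral: `∫₀^{2π} G·w/u dt = (4αρ²κ₀/c)·K₉` -/

section atomic

variable {g : ℝ} (hg : 0 < g)
include hg

/-- Continuity of `G·w/u` on the edge loop (`u > 0`). [folklore] -/
theorem continuous_gradSq_w_div_u_edge : Continuous fun t =>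
      lcGradSq IterLike.kappa0 g IterLike.Ra (IterLike.q0 g) (IterLike.ε / IterLike.Ra) t
        * lcAvgWeight IterLike.kappa0 g IterLike.Ra (IterLike.q0 g) (IterLike.ε / IterLike.Ra) t
        / lcU IterLike.Ra (IterLike.ε / IterLike.Ra) t :=
  (continuous_lcGradSq_edge.mul (continuous_w_edge hg)).div₀ continuous_lcU_edge fun t => (lcU_edge_pos t).ne'

/-- `T9`: **`∫₀^{2π} G·w/u dt = (κ₀·4αρ²/c)·K₉`** (`G = |∇Ψ|² = 4αρ²P/U`, `w = κ₀/(2c√u)`, `u = U`; half-angle substitution of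
`…MercierEdgeSubst`, both quarter periods, `t ↦ 2π − t` symmetry). This is `V′⟨B_p²⟩/(2π)·(2π)` — the one surface integral the
resistive index needs beyond the Mercier set (model-5 `surfaceAverageE_lcLoop_bsq_split`). [cite: Jardin2010, §5.3 eq. (5.30)] -/
theorem integral_gradSq_w_div_u_edge :
    ∫ t in (0 : ℝ)..(2 * π), lcGradSq IterLike.kappa0 g IterLike.Ra (IterLike.q0 g) (IterLike.ε / IterLike.Ra) t
        * lcAvgWeight IterLike.kappa0 g IterLike.Ra (IterLike.q0 g) (IterLike.ε / IterLike.Ra) t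
        / lcU IterLike.Ra (IterLike.ε / IterLike.Ra) t
      = IterLike.kappa0 * c4 / (2257675225 / 6032287802 : ℝ) * K9 := by
  have hg' := hg.ne'
  rw [integral_zero_two_pi_eq_theta _ (continuous_gradSq_w_div_u_edge hg)
    (fun t => by simp only [lcAvgWeight_edge hg', lcU_two_pi_sub, lcGradSq_two_pi_sub hg'])]
  have key : ∀ w ∈ uIcc (0:ℝ) 1,
      (lcGradSq IterLike.kappa0 g IterLike.Ra (IterLike.q0 g) (IterLike.ε / IterLike.Ra) (theta w)
          * lcAvgWeight IterLike.kappa0 g IterLike.Ra (IterLike.q0 g) (IterLike.ε / IterLike.Ra) (theta w)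
          / lcU IterLike.Ra (IterLike.ε / IterLike.Ra) (theta w)
        + lcGradSq IterLike.kappa0 g IterLike.Ra (IterLike.q0 g) (IterLike.ε / IterLike.Ra) (π - theta w)
          * lcAvgWeight IterLike.kappa0 g IterLike.Ra (IterLike.q0 g) (IterLike.ε / IterLike.Ra) (π - theta w)
          / lcU IterLike.Ra (IterLike.ε / IterLike.Ra) (π - theta w))
        * (2 / Real.sqrt (2 - w ^ 2))
      = IterLike.kappa0 * c4 / (2 * (2257675225 / 6032287802 : ℝ)) * (K9e.toFun w * Poly.eval [2] w) := by
    intro w hw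
    rw [uIcc01] at hw
    rw [lcAvgWeight_edge hg', lcAvgWeight_edge hg', lcGradSq_theta hg' hw, lcGradSq_pi_sub_theta hg' hw,
      lcU_theta hw, lcU_pi_sub_theta hw, toFun_K9e, eval_const_two]
    have hP1 : Pplus w ≠ 0 := (Pplus_pos hw).ne'
    have hP2 : Pminus w ≠ 0 := (Pminus_pos hw).ne'
    have hU1 : Uplus w ≠ 0 := (Uplus_pos hw).ne'
    have hU2 : Uminus w ≠ 0 := (Uminus_pos w).ne'
    have h3 : Real.sqrt (Uplus w) ≠ 0 := (Real.sqrt_pos.2 (Uplus_pos hw)).ne'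
    have h4 : Real.sqrt (Uminus w) ≠ 0 := (Real.sqrt_pos.2 (Uminus_pos w)).ne'
    have h5 : Real.sqrt (2 - w ^ 2) ≠ 0 := (sqrt_two_sub_pos hw).ne'
    have hc4 : c4 ≠ 0 := c4_pos.ne'
    field_simp
  rw [integral_congr key, intervalIntegral.integral_const_mul]
  unfold K9
  ring

end atomic

/-! ## §2 The two edge averages entering `⟨B²⟩`: `⟨1/R²⟩ = A4` (Mercier set) and the new `⟨B_p²⟩ = A9` -/

/-- `A9 := ⟨B_p²⟩ = ⟨|∇Ψ|²/R²⟩ = 4αρ²·K₉/K₁` of the edge surface (`g`-free). [cite: Jardin2010, §5.3 eq. (5.30)] -/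
def A9 : ℝ := c4 * K9 / K1

/-- `A9 = ⟨B_p²⟩ ∈ [0.0368264552452, 0.0368264552453]` (from the kernel brackets of `K₉`, `K₁`; width `10⁻¹³`). [folklore] -/
theorem A9_bounds : (92066138113 / 2500000000000 : ℝ) ≤ A9 ∧ A9 ≤ (368264552453 / 10000000000000 : ℝ) := by
  obtain ⟨h1l, h1h⟩ := K1_bounds; obtain ⟨h9l, h9h⟩ := K9_bounds
  have hK1 := K1_pos
  unfold A9
  constructor
  · rw [le_div_iff₀ hK1]
    calc (92066138113 / 2500000000000 : ℝ) * K1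
        ≤ (92066138113 / 2500000000000 : ℝ) * ((1950606333222713397908727/604462909807314587353088 : ℚ) : ℝ) := by gcongr
      _ ≤ c4 * ((937173892527426047294157/1208925819614629174706176 : ℚ) : ℝ) := by unfold c4; push_cast; norm_num
      _ ≤ c4 * K9 := by unfold c4; gcongr
  · rw [div_le_iff₀ hK1]
    calc c4 * K9 ≤ c4 * ((937173892527446230801675/1208925819614629174706176 : ℚ) : ℝ) := by unfold c4; gcongr
      _ ≤ (368264552453 / 10000000000000 : ℝ) * ((975303166611347439073091/302231454903657293676544 : ℚ) : ℝ) := by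
          unfold c4; push_cast; norm_num
      _ ≤ (368264552453 / 10000000000000 : ℝ) * K1 := by gcongr

/-- `A9 > 0`. [folklore] -/
theorem A9_pos : 0 < A9 := lt_of_lt_of_le (by norm_num) A9_bounds.1

/-- `A4 > 0`, `A6 > 0`, `A7 > 0`, `phihat > 0` (from their kernel brackets). [folklore] -/
theorem A4_A6_A7_phihat_pos : 0 < A4 ∧ 0 < A6 ∧ 0 < A7 ∧ 0 < phihat :=
  ⟨lt_of_lt_of_le (by norm_num) A4_bounds.1, lt_of_lt_of_le (by norm_num) A6_bounds.1,
    lt_of_lt_of_le (by norm_num) A7_bounds.1, lt_of_lt_of_le (by norm_num) phihat_bounds.1⟩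

/-- **`⟨B²⟩` of the EDGE surface of the typed equilibrium, free constant `g`: `⟨B²⟩ = g²·A4 + A9`** (model-5's `avgBsq_eq`
`= g²·∫w/u ÷ ∫w + ∫G·w/u ÷ ∫w`, with `T1`, `T6b` of `…MercierEdgeIntegrals1/2` and `T9`). [cite: Jardin2010, §5.3 eq. (5.30)] -/
theorem avgBsq_edge {g : ℝ} (hg : 0 < g) : IterLike.avgBsq g (IterLike.ε / IterLike.Ra) = g ^ 2 * A4 + A9 := by
  rw [IterLike.avgBsq_eq hg IterLike.edge_minorRadius.1 IterLike.edge_minorRadius.2, integral_w_div_u_edge hg,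
    integral_w_edge hg, integral_gradSq_w_div_u_edge hg]
  unfold A4 A9
  have hk := IterLike.kappa0_pos
  have hK := K1_pos
  have hc4 := c4_pos
  field_simp

/-! ## §3 `D_R` of the edge surface in closed form -/

/-- The `⟨B²⟩` denominator `Dn(g) := g²A4 + A9`. [folklore] -/
def Dn (g : ℝ) : ℝ := g ^ 2 * A4 + A9

/-- `Dn(g) > 0`. [folklore] -/
theorem Dn_pos (g : ℝ) : 0 < Dn g := by
  unfold Dn; have := A4_A6_A7_phihat_pos.1; have := A9_pos; positivity

/-- GGJ's `H` of the (volume-relabelled) edge record as a function of `g`: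
`H(g) = (⟨B²/G⟩/⟨B²⟩ − ⟨1/G⟩)/(2π·phihat) = ((g²A7 + A4)/(g²A4 + A9) − A6)/(2π·phihat)`
(model-5's `H = V′⟨B²/G⟩/Λ·(⟨σB²/G⟩/⟨B²/G⟩ − g/⟨B²⟩)` with `V′/Λ = −1/(2πg·phihat)`). [cite: Zheng2015, §2.3 eq. (2.64)] -/
def Hres (g : ℝ) : ℝ := (B2G g / Dn g - A6) / (2 * π * phihat)

/-- **THE RESISTIVE-INTERCHANGE INDEX OF THE EDGE SURFACE IN CLOSED FORM**:
`DR(g) := −(M₂ − M₀/g²)/(4π²·phihat²) + (H(g) − 1/2)²` (`M₂ = mercierSlope`, `M₀ = mercierIntercept`: Jardin's `F = M₂g² − M₀`,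
`D_I = mercierD − 1/4 = −F·V′²/Λ²`, `D_R = D_I + (H − 1/2)²`). [cite: Zheng2015, §3.2 eq. (3.42)] -/
def DR (g : ℝ) : ℝ := -(mercierSlope - mercierIntercept / g ^ 2) / (4 * π ^ 2 * phihat ^ 2) + (Hres g - 1 / 2) ^ 2

/-- `Φ″ ≠ 0` on the edge record (`Φ″ = g·phihat·Vp > 0`: positive shear). [cite: Jardin2010, §8.5 eq. (8.134)] -/
theorem ggjData_edge_Φ''_ne {g : ℝ} (hg : 0 < g) : (IterLike.ggjData g (IterLike.ε / IterLike.Ra)).Φ'' ≠ 0 := by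
  show (lcEdgeData g).Φ'' ≠ 0
  rw [lcEdgeData_Φ'' hg]
  exact (mul_pos (mul_pos hg A4_A6_A7_phihat_pos.2.2.2) Vp_pos).ne'

/-- **model-5's `IterLike.resistiveIndex` OF THE EDGE SURFACE EQUALS THE CLOSED FORM `DR g`** (`g > 0`): `resistiveIndex_eq_mercierD`
+ `avgBsq_edge` + the edge field lemmas of `…MercierEdgeKernel` + `mercierF_lcEdgeData`/`mercierF_eq_quadratic`.
[cite: Zheng2015, §3.2 eq. (3.42)] -/
theorem resistiveIndex_edge_eq {g : ℝ} (hg : 0 < g) : IterLike.resistiveIndex g (IterLike.ε / IterLike.Ra) = DR g := by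
  have hΦ := ggjData_edge_Φ''_ne hg
  rw [IterLike.resistiveIndex_eq_mercierD hg IterLike.edge_minorRadius.1 IterLike.edge_minorRadius.2 hΦ, avgBsq_edge hg]
  change (lcEdgeData g).mercierD - 1 / 4
      + ((lcEdgeData g).V' * (lcEdgeData g).gB2 / (lcEdgeData g).shear
          * ((lcEdgeData g).gσB2 / (lcEdgeData g).gB2 - g / (g ^ 2 * A4 + A9)) - 1 / 2) ^ 2 = DR g
  have hΨ2 : (lcEdgeData g).Ψ'' = 0 := rfl
  unfold SurfaceData.mercierD SurfaceData.shear
  rw [mercierF_lcEdgeData hg, mercierF_eq_quadratic hg.ne', lcEdgeData_V' hg, lcEdgeData_Φ'' hg, lcEdgeData_Ψ',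
    lcEdgeData_gB2 hg, lcEdgeData_gσB2 hg, hΨ2]
  unfold DR Hres Dn B2G
  obtain ⟨hA4, hA6, hA7, hph⟩ := A4_A6_A7_phihat_pos
  have hVp := Vp_pos
  have hπ := Real.pi_pos
  have hD : g ^ 2 * A4 + A9 ≠ 0 := (Dn_pos g).ne'
  have hN : g ^ 2 * A7 + A4 ≠ 0 := by positivity
  have hg' := hg.ne'
  field_simp
  ring

/-! ## §4 Sign structure: `D_R < 0 ↔ resNum < 0` with a polynomial numerator -/

/-- `X(g) := g²A7 + A4 − (A6 + π·phihat)·(g²A4 + A9)` (so `H − 1/2 = X/(2π·phihat·Dn)`). [folklore] -/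
def Xr (g : ℝ) : ℝ := B2G g - (A6 + π * phihat) * Dn g

/-- `resNum(g) := X(g)²·g² − (M₂g² − M₀)·Dn(g)²` — the sign-carrying polynomial numerator of `D_R`. [folklore] -/
def resNum (g : ℝ) : ℝ := Xr g ^ 2 * g ^ 2 - (mercierSlope * g ^ 2 - mercierIntercept) * Dn g ^ 2

/-- `H(g) − 1/2 = X(g)/(2π·phihat·Dn(g))`. [folklore] -/
theorem Hres_sub_half (g : ℝ) : Hres g - 1 / 2 = Xr g / (2 * π * phihat * Dn g) := by
  unfold Hres Xr
  have hph := A4_A6_A7_phihat_pos.2.2.2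
  have hD := (Dn_pos g).ne'
  have hπ := Real.pi_pos
  field_simp
  ring

/-- `D_R = resNum/(4π²·phihat²·Dn²·g²)` (`g ≠ 0`). [folklore] -/
theorem DR_eq_resNum_div {g : ℝ} (hg : g ≠ 0) :
    DR g = resNum g / (4 * π ^ 2 * phihat ^ 2 * Dn g ^ 2 * g ^ 2) := by
  unfold DR resNum
  rw [Hres_sub_half]
  unfold Xr
  have hph := A4_A6_A7_phihat_pos.2.2.2
  have hD := (Dn_pos g).ne'
  have hπ := Real.pi_pos
  field_simp
  ring

/-- `D_R < 0 ↔ resNum < 0` (`g ≠ 0`). [folklore] -/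
theorem DR_neg_iff {g : ℝ} (hg : g ≠ 0) : DR g < 0 ↔ resNum g < 0 := by
  have hph := A4_A6_A7_phihat_pos.2.2.2
  have hD := Dn_pos g
  have hden : 0 < 4 * π ^ 2 * phihat ^ 2 * Dn g ^ 2 * g ^ 2 := by positivity
  rw [DR_eq_resNum_div hg, div_lt_iff₀ hden, zero_mul]

/-- `0 < D_R ↔ 0 < resNum` (`g ≠ 0`). [folklore] -/
theorem DR_pos_iff {g : ℝ} (hg : g ≠ 0) : 0 < DR g ↔ 0 < resNum g := by
  have hph := A4_A6_A7_phihat_pos.2.2.2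
  have hD := Dn_pos g
  have hden : 0 < 4 * π ^ 2 * phihat ^ 2 * Dn g ^ 2 * g ^ 2 := by positivity
  rw [DR_eq_resNum_div hg, lt_div_iff₀ hden, zero_mul]

/-- Generic NEGATIVE sign test for `resNum` from one-sided data: `|X(g)| ≤ xb`, `Dn(g) ≥ dlo ≥ 0`, `M₂g² − M₀ ≥ mlo ≥ 0` and the
rational check `xb²g² < mlo·dlo²` give `resNum(g) < 0`. [folklore] -/
theorem resNum_neg_of {g xb dlo mlo : ℝ} (hX : |Xr g| ≤ xb) (hD : dlo ≤ Dn g) (hd0 : 0 ≤ dlo)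
    (hM : mlo ≤ mercierSlope * g ^ 2 - mercierIntercept) (hm0 : 0 ≤ mlo) (h : xb ^ 2 * g ^ 2 < mlo * dlo ^ 2) :
    resNum g < 0 := by
  unfold resNum
  have hxb : 0 ≤ xb := (abs_nonneg _).trans hX
  have h1 : Xr g ^ 2 ≤ xb ^ 2 := by
    rw [← sq_abs (Xr g)]; exact pow_le_pow_left₀ (abs_nonneg _) hX 2
  have h2 : dlo ^ 2 ≤ Dn g ^ 2 := pow_le_pow_left₀ hd0 hD 2
  have h3 : mlo * dlo ^ 2 ≤ (mercierSlope * g ^ 2 - mercierIntercept) * Dn g ^ 2 :=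
    mul_le_mul hM h2 (by positivity) (hm0.trans hM)
  have h4 : Xr g ^ 2 * g ^ 2 ≤ xb ^ 2 * g ^ 2 := mul_le_mul_of_nonneg_right h1 (sq_nonneg g)
  linarith

/-- Generic POSITIVE sign test: `X(g) ≤ −xlo ≤ 0`, `0 ≤ Dn(g) ≤ dhi`, `0 ≤ M₂g² − M₀ ≤ mhi` and `mhi·dhi² < xlo²g²` give
`0 < resNum(g)`. [folklore] -/
theorem resNum_pos_of {g xlo dhi mhi : ℝ} (hX : Xr g ≤ -xlo) (hx0 : 0 ≤ xlo) (hD : Dn g ≤ dhi)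
    (hM : mercierSlope * g ^ 2 - mercierIntercept ≤ mhi) (hM0 : 0 ≤ mercierSlope * g ^ 2 - mercierIntercept)
    (h : mhi * dhi ^ 2 < xlo ^ 2 * g ^ 2) : 0 < resNum g := by
  unfold resNum
  have hD0 : 0 ≤ Dn g := (Dn_pos g).le
  have h1 : xlo ^ 2 ≤ Xr g ^ 2 := by nlinarith
  have h2 : Dn g ^ 2 ≤ dhi ^ 2 := pow_le_pow_left₀ hD0 hD 2
  have h3 : (mercierSlope * g ^ 2 - mercierIntercept) * Dn g ^ 2 ≤ mhi * dhi ^ 2 :=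
    mul_le_mul hM h2 (sq_nonneg _) (hM0.trans hM)
  have h4 : xlo ^ 2 * g ^ 2 ≤ Xr g ^ 2 * g ^ 2 := mul_le_mul_of_nonneg_right h1 (sq_nonneg g)
  linarith

/-- Linear enclosure of `X(g)` at fixed `g` from brackets of `S = A6 + π·phihat`, `Dn(g)` and `B2G(g)`:
`nlo − shi·dhi ≤ X(g) ≤ nhi − slo·dlo` (`slo, dlo ≥ 0`). [folklore] -/
theorem Xr_bounds_of {g slo shi dlo dhi nlo nhi : ℝ} (hS : slo ≤ A6 + π * phihat ∧ A6 + π * phihat ≤ shi)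
    (hs0 : 0 ≤ slo) (hD : dlo ≤ Dn g ∧ Dn g ≤ dhi) (hd0 : 0 ≤ dlo) (hN : nlo ≤ B2G g ∧ B2G g ≤ nhi) :
    nlo - shi * dhi ≤ Xr g ∧ Xr g ≤ nhi - slo * dlo := by
  unfold Xr
  have h1 : (A6 + π * phihat) * Dn g ≤ shi * dhi :=
    mul_le_mul hS.2 hD.2 (hd0.trans hD.1) (hs0.trans (hS.1.trans hS.2))
  have h2 : slo * dlo ≤ (A6 + π * phihat) * Dn g := mul_le_mul hS.1 hD.1 hd0 (hs0.trans hS.1)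
  constructor <;> linarith

/-! ## §5 Common rational brackets -/

/-- `π·phihat ∈ [7.80074508824, 7.80074508825]`. [folklore] -/
theorem piPhihat_bounds : (97509313603 / 12500000000 : ℝ) ≤ π * phihat ∧ π * phihat ≤ (31202980353 / 4000000000 : ℝ) := by
  obtain ⟨hPl, hPh⟩ := phihat_bounds
  have hpi1 := Real.pi_gt_d20
  have hpi2 := Real.pi_lt_d20
  constructor
  · calc (97509313603 / 12500000000 : ℝ) ≤ 3.14159265358979323846 * (2483054281187 / 1000000000000 : ℝ) := by norm_num
      _ ≤ π * phihat := mul_le_mul hpi1.le hPl (by norm_num) Real.pi_pos.le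
  · calc π * phihat ≤ 3.14159265358979323847 * (620763570297 / 250000000000 : ℝ) :=
          mul_le_mul hpi2.le hPh (by linarith) (by norm_num)
      _ ≤ (31202980353 / 4000000000 : ℝ) := by norm_num

/-- `S = A6 + π·phihat ∈ [48.149593891399, 48.149593891503]`. [folklore] -/
theorem S_bounds : (48149593891399 / 1000000000000 : ℝ) ≤ A6 + π * phihat
    ∧ A6 + π * phihat ≤ (48149593891503 / 1000000000000 : ℝ) := by
  obtain ⟨h6l, h6h⟩ := A6_bounds; obtain ⟨hPl, hPh⟩ := piPhihat_bounds
  constructor <;> linarith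

/-! ## §6 Exact monotone structure of `D_R(g)` (numerics only in two certified SIGN conditions) -/

/-- `A4² < A7·A9` (`⟨1/R²⟩² < ⟨1/(R²G)⟩·⟨G/R²⟩` on the surface; certified from the brackets). [folklore] -/
theorem A4_sq_lt_A7_mul_A9 : A4 ^ 2 < A7 * A9 := by
  obtain ⟨hA4l, hA4h⟩ := A4_bounds; obtain ⟨hA7l, hA7h⟩ := A7_bounds; obtain ⟨hA9l, hA9h⟩ := A9_bounds
  have h1 : (56976811031807 / 1000000000000 : ℝ) * (92066138113 / 2500000000000 : ℝ) ≤ A7 * A9 := mul_le_mul hA7l hA9l (by norm_num) (le_trans (by norm_num) hA7l)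
  have h2 : A4 ^ 2 ≤ (1239462661663 / 1000000000000 : ℝ) ^ 2 := pow_le_pow_left₀ (le_trans (by norm_num) hA4l) hA4h 2
  have h3 : (1239462661663 / 1000000000000 : ℝ) ^ 2 < (56976811031807 / 1000000000000 : ℝ) * (92066138113 / 2500000000000 : ℝ) := by norm_num
  linarith

/-- `X(g) < 0` for EVERY real `g` (so `H < 1/2`): `A7 < S·A4` and `A4 < S·A9` with `S = A6 + π·phihat`. [folklore] -/
theorem Xr_neg (g : ℝ) : Xr g < 0 := by
  obtain ⟨hA4l, hA4h⟩ := A4_bounds; obtain ⟨hA7l, hA7h⟩ := A7_bounds; obtain ⟨hA9l, hA9h⟩ := A9_bounds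
  obtain ⟨hSl, hSh⟩ := S_bounds
  have h1 : (48149593891399 / 1000000000000 : ℝ) * (619731330831 / 500000000000 : ℝ) ≤ (A6 + π * phihat) * A4 := mul_le_mul hSl hA4l (by norm_num) (le_trans (by norm_num) hSl)
  have h2 : (48149593891399 / 1000000000000 : ℝ) * (92066138113 / 2500000000000 : ℝ) ≤ (A6 + π * phihat) * A9 := mul_le_mul hSl hA9l (by norm_num) (le_trans (by norm_num) hSl)
  have h3 : A7 < (A6 + π * phihat) * A4 := by linarith
  have h4 : A4 < (A6 + π * phihat) * A9 := by linarith
  unfold Xr B2G Dn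
  have hg2 : 0 ≤ g ^ 2 := sq_nonneg g
  nlinarith [mul_le_mul_of_nonneg_left h3.le hg2]

/-- `H(g) < 1/2` for every `g`. [cite: Zheng2015, §2.3 eq. (2.64)] -/
theorem Hres_lt_half (g : ℝ) : Hres g < 1 / 2 := by
  have h := Hres_sub_half g
  have hph := A4_A6_A7_phihat_pos.2.2.2
  have hden : 0 < 2 * π * phihat * Dn g := by have := Dn_pos g; positivity
  have : Xr g / (2 * π * phihat * Dn g) < 0 := div_neg_of_neg_of_pos (Xr_neg g) hden
  linarith

/-- `H` is monotone increasing in `g ≥ 0` (`⟨B²/G⟩/⟨B²⟩ = (g²A7 + A4)/(g²A4 + A9)` increases since `A7A9 > A4²`).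
[cite: Zheng2015, §2.3 eq. (2.64)] -/
theorem Hres_mono {g₁ g₂ : ℝ} (h0 : 0 ≤ g₁) (h : g₁ ≤ g₂) : Hres g₁ ≤ Hres g₂ := by
  unfold Hres
  have hph := A4_A6_A7_phihat_pos.2.2.2
  apply div_le_div_of_nonneg_right _ (by positivity)
  suffices hq : B2G g₁ / Dn g₁ ≤ B2G g₂ / Dn g₂ by linarith
  rw [div_le_div_iff₀ (Dn_pos g₁) (Dn_pos g₂)]
  unfold B2G Dn
  have hsq : g₁ ^ 2 ≤ g₂ ^ 2 := pow_le_pow_left₀ h0 h 2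
  have hc := A4_sq_lt_A7_mul_A9
  nlinarith [mul_nonneg (sub_nonneg.2 hsq) (sub_nonneg.2 hc.le)]

/-- **`D_R(g)` is STRICTLY DECREASING on `(0, ∞)`** (`M₀ > 0` makes `−(M₂ − M₀/g²)` strictly decreasing; `H ↑`, `H < 1/2`
make `(H − 1/2)²` non-increasing). [cite: Zheng2015, §3.2 eq. (3.42)] -/
theorem DR_strictAntiOn : StrictAntiOn DR (Set.Ioi 0) := by
  intro g₁ h₁ g₂ h₂ hlt
  simp only [Set.mem_Ioi] at h₁ h₂
  have hH := Hres_mono h₁.le hlt.le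
  have hH2 := Hres_lt_half g₂
  have hsq : (Hres g₂ - 1 / 2) ^ 2 ≤ (Hres g₁ - 1 / 2) ^ 2 := by
    nlinarith [mul_nonneg (sub_nonneg.2 hH) (by linarith : (0:ℝ) ≤ 1 - Hres g₁ - Hres g₂)]
  have hI : 0 < mercierIntercept := lt_of_lt_of_le (by norm_num) mercierIntercept_bounds.1
  have hg : g₁ ^ 2 < g₂ ^ 2 := by nlinarith
  have hterm : mercierIntercept / g₂ ^ 2 < mercierIntercept / g₁ ^ 2 :=
    div_lt_div_of_pos_left hI (by positivity) hg
  have hph := A4_A6_A7_phihat_pos.2.2.2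
  have hden : 0 < 4 * π ^ 2 * phihat ^ 2 := by positivity
  have h3 : -(mercierSlope - mercierIntercept / g₂ ^ 2) / (4 * π ^ 2 * phihat ^ 2)
      < -(mercierSlope - mercierIntercept / g₁ ^ 2) / (4 * π ^ 2 * phihat ^ 2) :=
    div_lt_div_of_pos_right (by linarith) hden
  show DR g₂ < DR g₁
  unfold DR
  linarith

/-- **model-5's `resistiveIndex` of the edge surface is strictly decreasing in the free constant on `(0, ∞)`.**
[cite: Zheng2015, §3.2 eq. (3.42)] -/
theorem resistiveIndex_edge_strictAntiOn :
    StrictAntiOn (fun g => IterLike.resistiveIndex g (IterLike.ε / IterLike.Ra)) (Set.Ioi 0) := by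
  intro g₁ h₁ g₂ h₂ hlt
  show IterLike.resistiveIndex g₂ (IterLike.ε / IterLike.Ra) < IterLike.resistiveIndex g₁ (IterLike.ε / IterLike.Ra)
  rw [resistiveIndex_edge_eq (show 0 < g₁ from h₁), resistiveIndex_edge_eq (show 0 < g₂ from h₂)]
  exact DR_strictAntiOn h₁ h₂ hlt

/-- One negative value propagates upward: `D_R(g₀) < 0`, `0 < g₀ ≤ g` ⇒ `D_R(g) < 0`. [folklore] -/
theorem DR_neg_of_le {g₀ g : ℝ} (h0 : 0 < g₀) (h : g₀ ≤ g) (hneg : DR g₀ < 0) : DR g < 0 := by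
  rcases eq_or_lt_of_le h with rfl | hlt
  · exact hneg
  · exact (DR_strictAntiOn (Set.mem_Ioi.2 h0) (Set.mem_Ioi.2 (h0.trans hlt)) hlt).trans hneg

/-- One positive value propagates downward: `0 < D_R(g₀)`, `0 < g ≤ g₀` ⇒ `0 < D_R(g)`. [folklore] -/
theorem DR_pos_of_le {g g₀ : ℝ} (h0 : 0 < g) (h : g ≤ g₀) (hpos : 0 < DR g₀) : 0 < DR g := by
  rcases eq_or_lt_of_le h with rfl | hlt
  · exact hpos
  · exact hpos.trans (DR_strictAntiOn (Set.mem_Ioi.2 h0) (Set.mem_Ioi.2 (h0.trans hlt)) hlt)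

end Summit.Ventures.FusionMHD.Bench.SolovevPCFIter.MercierEdge

end
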